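import Literature.AlgebraicGeometry.Motives.HodgeThetaSubalgebraSymplecticRankSixDichotomy
import Mathlib.Algebra.Lie.Engel
import HarnessLib

/-!
# The `Θ`-subalgebra theorem in rank six, PART 3a: structure of the E³-type skeleton
# (Moonen–Zarhin 1999 (2.3)/(2.5), Type I(1), `g = 3`)

Family `hodge`, layer `Literature/AlgebraicGeometry/Motives`. Research context: cell `pub-hodge-ring2` (HONEST
FRAMING: research route conditional on HC_CM; not a corollary; Q11.4-sentence-2 already refuted in dim ≥ 3),
Literature lane, programme R13 «generic abelian threefolds», the abstract Lie step, PART 3a. UNCONDITIONAL linear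
algebra over `ℂ`; theorems only, no definition, no named fact (D-0026), no `sorry`. Sequel of PARTS 1, 2a, 2b
(`HodgeThetaSubalgebraSymplecticRankSix`, `…Reduction`, `…Dichotomy`): the dichotomy
`SymplecticThetaSix.core_dichotomy` leaves the E³-TYPE SKELETON — `𝔊₊ = ℂB₀`, `𝔊₋ = ℂC₁` for a unit pair
`B₀C₁|_P = 1`, `C₁B₀|_Q = 1` — whose structure this file develops (towards its arithmetic exclusion under
`End_Hdg(V) = ℚ`, PART 3b).

SETTING. `𝔊 ⊆ End(M)` bracket-closed containing an involution `T` with eigenspaces `P` (`+1`), `Q` (`−1`); no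
`𝔊`-stable subspace other than `0`, `M`; the skeleton data `B₀ ∈ 𝔊₊`, `C₁ ∈ 𝔊₋` as above with `𝔊₊ = ℂB₀`,
`𝔊₋ = ℂC₁`. The CENTRALISER `𝔰 = {S ∈ 𝔊 : SB₀ = B₀S, SC₁ = C₁S}` (elements of `𝔰` commute with `T = [B₀, C₁]`,
so preserve `P` and `Q`).

WHAT IS PROVED.
* §1 `SymplecticThetaSix.skeleton_bracket` — `[B₀, C₁] = T`; `SymplecticThetaSix.skeleton_levi` — every `Z ∈ 𝔊₀`
  is `yT + S` with `S ∈ 𝔰` (`[Z, B₀] = λB₀`, `[Z, C₁] = μC₁`, and `0 = [Z, T] = (λ + μ)T`; `S = Z − (λ/2)T`), so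
  `𝔊 = 𝔞₁ ⊕ 𝔰` with `𝔞₁ = ⟨C₁, T, B₀⟩ ≅ 𝔰𝔩₂` and `[𝔞₁, 𝔰] = 0`; `SymplecticThetaSix.skeleton_irreducible` — a
  subspace of `P` stable under `𝔰` is `0` or `P` (orbit lemma of PART 1).
* §2 `SymplecticThetaSix.skeleton_exists_nonNilpotent` — if `dim P = 3`, some `S ∈ 𝔰` is not nilpotent on `P`
  (ENGEL'S THEOREM, Mathlib `LieModule.isNilpotent_iff_forall'`: otherwise `𝔰` has a common kernel line in `P`,
  which §1 forbids).

NOT here (PART 3b): `S` is semisimple with eigenvalues `e, 0, −e` on `P`, `𝔰 = ⟨S, E′, F′⟩ = 𝔰𝔬(P, s)` for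
`s(p, p′) = ω(p, C₁p′)`, the Killing form of `𝔊 = 𝔞₁ ⊕ 𝔰` versus the trace form of `M` (`β = ¾κ` on `𝔞₁`,
`β = 2κ` on `𝔰`), and the exclusion of the skeleton under `End_Hdg(V) = ℚ` by descent of `Rad(β − 2κ) = 𝔰`.

## References

* [MoonenZarhin1999LowDim] B. Moonen, Yu. Zarhin, Hodge classes on abelian varieties of low dimension, Math.
  Ann. 315 (1999) 711–733 = arXiv:math/9901113, §2 (2.3) Type I(1), (2.5) (Type III, multiplicities).
* [Humphreys1972] J. E. Humphreys, Introduction to Lie Algebras and Representation Theory (1972), §3.3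
  (Engel's theorem), §19.1.
* [Gordon1997] B. B. Gordon, A survey of the Hodge conjecture for abelian varieties, arXiv:alg-geom/9709030,
  §6 (proof of Thm. 6.3.3).
-/

noncomputable section

namespace Literature.AlgebraicGeometry.Motives

namespace HodgeStructure

variable {M : Type*} [AddCommGroup M] [Module ℂ M]


/-! ### §1 `[B₀, C₁] = T`, the Levi `𝔊₀ = ℂT ⊕ 𝔰`, irreducibility of `𝔰` on `P` -/

section Levi

/-- **`[B₀, C₁] = T`** for a unit pair: on `P`, `B₀C₁ − C₁B₀ = 1 − 0`; on `Q`, `0 − 1`.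
[cite: MoonenZarhin1999LowDim, §2 (2.3)] -/
theorem SymplecticThetaSix.skeleton_bracket {T : Module.End ℂ M} {P Q : Submodule ℂ M}
    (hP : ∀ x ∈ P, T x = x) (hQ : ∀ x ∈ Q, T x = -x)
    (hPmem : ∀ v, (2 : ℂ)⁻¹ • (v + T v) ∈ P) (hQmem : ∀ v, (2 : ℂ)⁻¹ • (v - T v) ∈ Q)
    {B₀ C₁ : Module.End ℂ M} (hB₀P : ∀ p ∈ P, B₀ p = 0) (hC₁Q : ∀ q ∈ Q, C₁ q = 0)
    (hBC : ∀ p ∈ P, B₀ (C₁ p) = p) (hCB : ∀ q ∈ Q, C₁ (B₀ q) = q) :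
    B₀ * C₁ - C₁ * B₀ = T := by
  have hPQv : ∀ v, (2 : ℂ)⁻¹ • (v + T v) + (2 : ℂ)⁻¹ • (v - T v) = v := fun v => by module
  ext v
  rw [← hPQv v, map_add, map_add, LinearMap.sub_apply, LinearMap.sub_apply, Module.End.mul_apply,
    Module.End.mul_apply, Module.End.mul_apply, Module.End.mul_apply, hBC _ (hPmem v), hB₀P _ (hPmem v),
    map_zero, sub_zero, hC₁Q _ (hQmem v), map_zero, zero_sub, hCB _ (hQmem v), hP _ (hPmem v), hQ _ (hQmem v)]

/-- **The Levi of the skeleton: `𝔊₀ = ℂT ⊕ 𝔰`.** If `𝔊₊ = ℂB₀` and `𝔊₋ = ℂC₁` for a unit pair, then every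
`Z ∈ 𝔊` preserving `P` and `Q` is `Z = yT + S` with `S ∈ 𝔊` commuting with `B₀` and `C₁`: `[Z, B₀] = λB₀` and
`[Z, C₁] = μC₁` (the lines), `0 = [Z, [B₀, C₁]] = (λ + μ)T`, and `S = Z − (λ/2)T` (`[T, B₀] = 2B₀`,
`[T, C₁] = −2C₁`). Hence `𝔊 = 𝔞₁ ⊕ 𝔰`, `𝔞₁ = ⟨C₁, T, B₀⟩ ≅ 𝔰𝔩₂`, `[𝔞₁, 𝔰] = 0` (Moonen–Zarhin (2.5):
`𝔰𝔩₂ ⊗ 1 ⊕ 1 ⊗ 𝔰`). [cite: MoonenZarhin1999LowDim, §2 (2.3), (2.5)] -/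
theorem SymplecticThetaSix.skeleton_levi (𝔊 : Submodule ℂ (Module.End ℂ M))
    (hbr : ∀ Y ∈ 𝔊, ∀ Z ∈ 𝔊, Y * Z - Z * Y ∈ 𝔊) {T : Module.End ℂ M} {P Q : Submodule ℂ M}
    (hP : ∀ x ∈ P, T x = x) (hQ : ∀ x ∈ Q, T x = -x)
    (hPmem : ∀ v, (2 : ℂ)⁻¹ • (v + T v) ∈ P) (hQmem : ∀ v, (2 : ℂ)⁻¹ • (v - T v) ∈ Q) (hPne : P ≠ ⊥)
    {B₀ C₁ : Module.End ℂ M} (hB₀𝔊 : B₀ ∈ 𝔊) (hB₀P : ∀ p ∈ P, B₀ p = 0) (hB₀im : ∀ v, B₀ v ∈ P)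
    (hC₁𝔊 : C₁ ∈ 𝔊) (hC₁Q : ∀ q ∈ Q, C₁ q = 0) (hC₁im : ∀ v, C₁ v ∈ Q)
    (hBC : ∀ p ∈ P, B₀ (C₁ p) = p) (hCB : ∀ q ∈ Q, C₁ (B₀ q) = q)
    (hlineS : ∀ B ∈ 𝔊, (∀ p ∈ P, B p = 0) → (∀ v, B v ∈ P) → ∃ c : ℂ, B = c • B₀)
    (hlineC : ∀ C ∈ 𝔊, (∀ q ∈ Q, C q = 0) → (∀ v, C v ∈ Q) → ∃ c : ℂ, C = c • C₁)
    {Z : Module.End ℂ M} (hZ : Z ∈ 𝔊) (hZP : ∀ p ∈ P, Z p ∈ P) (hZQ : ∀ q ∈ Q, Z q ∈ Q) :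
    ∃ y : ℂ, (Z - y • T) ∈ 𝔊 ∧ (Z - y • T) * B₀ = B₀ * (Z - y • T) ∧ (Z - y • T) * C₁ = C₁ * (Z - y • T) := by
  have hPQv : ∀ v, (2 : ℂ)⁻¹ • (v + T v) + (2 : ℂ)⁻¹ • (v - T v) = v := fun v => by module
  have hT : B₀ * C₁ - C₁ * B₀ = T := SymplecticThetaSix.skeleton_bracket hP hQ hPmem hQmem hB₀P hC₁Q hBC hCB
  have hT𝔊 : T ∈ 𝔊 := hT ▸ hbr B₀ hB₀𝔊 C₁ hC₁𝔊
  -- `[Z, B₀] = λ B₀`, `[Z, C₁] = μ C₁`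
  obtain ⟨l, hl⟩ := hlineS (Z * B₀ - B₀ * Z) (hbr Z hZ B₀ hB₀𝔊) (fun p hp => by
    rw [LinearMap.sub_apply, Module.End.mul_apply, Module.End.mul_apply, hB₀P p hp, map_zero,
      hB₀P _ (hZP p hp), sub_zero]) (fun v => sub_mem (hZP _ (hB₀im v)) (hB₀im _))
  obtain ⟨m, hm⟩ := hlineC (Z * C₁ - C₁ * Z) (hbr Z hZ C₁ hC₁𝔊) (fun q hq => by
    rw [LinearMap.sub_apply, Module.End.mul_apply, Module.End.mul_apply, hC₁Q q hq, map_zero,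
      hC₁Q _ (hZQ q hq), sub_zero]) (fun v => sub_mem (hZQ _ (hC₁im v)) (hC₁im _))
  -- `[Z, T] = 0`
  have hZT : Z * T - T * Z = 0 := by
    ext v
    rw [← hPQv v, LinearMap.zero_apply, map_add, LinearMap.sub_apply, LinearMap.sub_apply,
      Module.End.mul_apply, Module.End.mul_apply, Module.End.mul_apply, Module.End.mul_apply, hP _ (hPmem v),
      hP _ (hZP _ (hPmem v)), sub_self, zero_add, hQ _ (hQmem v), hQ _ (hZQ _ (hQmem v)), map_neg, sub_self]
  -- `0 = [Z, [B₀, C₁]] = (λ + μ) T`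
  have hlm : (l + m) • T = 0 := by
    have e : Z * T - T * Z = (Z * B₀ - B₀ * Z) * C₁ + B₀ * (Z * C₁ - C₁ * Z) - (Z * C₁ - C₁ * Z) * B₀ -
        C₁ * (Z * B₀ - B₀ * Z) := by rw [← hT]; noncomm_ring
    rw [hZT, hl, hm, smul_mul_assoc, mul_smul_comm, smul_mul_assoc, mul_smul_comm] at e
    rw [add_smul, ← hT]
    rw [e]
    module
  have hlm0 : l + m = 0 := by
    by_contra h
    apply hPne
    rw [eq_bot_iff]
    intro p hp
    rw [Submodule.mem_bot]
    have h1 := congrArg (fun f : Module.End ℂ M => f p) hlm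
    simp only [LinearMap.smul_apply, hP p hp, LinearMap.zero_apply] at h1
    exact (smul_eq_zero.1 h1).resolve_left h
  -- `[T, B₀] = 2 B₀`, `[T, C₁] = -2 C₁`
  have hTB : T * B₀ - B₀ * T = (2 : ℂ) • B₀ := by
    ext v
    obtain ⟨p, hp, q, hq, rfl⟩ : ∃ p ∈ P, ∃ q ∈ Q, v = p + q := ⟨_, hPmem v, _, hQmem v, (hPQv v).symm⟩
    have h1 : T (B₀ q) = B₀ q := hP _ (hB₀im q)
    rw [LinearMap.sub_apply, LinearMap.smul_apply, Module.End.mul_apply, Module.End.mul_apply, map_add B₀,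
      hB₀P p hp, zero_add, h1, map_add T, hP p hp, hQ q hq, map_add B₀, hB₀P p hp, zero_add, map_neg,
      sub_neg_eq_add, two_smul]
  have hTC : T * C₁ - C₁ * T = -((2 : ℂ) • C₁) := by
    ext v
    obtain ⟨p, hp, q, hq, rfl⟩ : ∃ p ∈ P, ∃ q ∈ Q, v = p + q := ⟨_, hPmem v, _, hQmem v, (hPQv v).symm⟩
    have h1 : T (C₁ p) = -C₁ p := hQ _ (hC₁im p)
    rw [LinearMap.sub_apply, LinearMap.neg_apply, LinearMap.smul_apply, Module.End.mul_apply,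
      Module.End.mul_apply, map_add C₁, hC₁Q q hq, add_zero, h1, map_add T, hP p hp, hQ q hq, map_add C₁,
      map_neg, hC₁Q q hq, neg_zero, add_zero, two_smul, neg_add']
  refine ⟨(2 : ℂ)⁻¹ * l, sub_mem hZ (𝔊.smul_mem _ hT𝔊), ?_, ?_⟩
  · -- `[S, B₀] = λ B₀ - (λ/2) [T, B₀] = 0`
    rw [← sub_eq_zero]
    have e : (Z - ((2 : ℂ)⁻¹ * l) • T) * B₀ - B₀ * (Z - ((2 : ℂ)⁻¹ * l) • T) =
        (Z * B₀ - B₀ * Z) - ((2 : ℂ)⁻¹ * l) • (T * B₀ - B₀ * T) := by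
      rw [sub_mul, mul_sub, smul_mul_assoc, mul_smul_comm, smul_sub]
      abel
    rw [e, hl, hTB, smul_smul]
    module
  · rw [← sub_eq_zero]
    have e : (Z - ((2 : ℂ)⁻¹ * l) • T) * C₁ - C₁ * (Z - ((2 : ℂ)⁻¹ * l) • T) =
        (Z * C₁ - C₁ * Z) - ((2 : ℂ)⁻¹ * l) • (T * C₁ - C₁ * T) := by
      rw [sub_mul, mul_sub, smul_mul_assoc, mul_smul_comm, smul_sub]
      abel
    have hm' : m = -l := by linear_combination hlm0
    rw [e, hm, hTC, hm', smul_neg, smul_smul]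
    module

/-- Elements of `𝔰` (commuting with `B₀` and `C₁`) commute with `T = [B₀, C₁]`, hence preserve `P` and `Q`.
[cite: MoonenZarhin1999LowDim, §2 (2.5)] -/
theorem SymplecticThetaSix.skeleton_mapsTo {T : Module.End ℂ M} {P Q : Submodule ℂ M}
    (hP : ∀ x ∈ P, T x = x) (hQ : ∀ x ∈ Q, T x = -x)
    (hPmem : ∀ v, (2 : ℂ)⁻¹ • (v + T v) ∈ P) (hQmem : ∀ v, (2 : ℂ)⁻¹ • (v - T v) ∈ Q)
    {B₀ C₁ : Module.End ℂ M} (hB₀P : ∀ p ∈ P, B₀ p = 0) (hC₁Q : ∀ q ∈ Q, C₁ q = 0)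
    (hBC : ∀ p ∈ P, B₀ (C₁ p) = p) (hCB : ∀ q ∈ Q, C₁ (B₀ q) = q)
    {S : Module.End ℂ M} (hSB : S * B₀ = B₀ * S) (hSC : S * C₁ = C₁ * S) :
    (∀ p ∈ P, S p ∈ P) ∧ (∀ q ∈ Q, S q ∈ Q) := by
  have hT : B₀ * C₁ - C₁ * B₀ = T := SymplecticThetaSix.skeleton_bracket hP hQ hPmem hQmem hB₀P hC₁Q hBC hCB
  have hST : S * T = T * S := by
    rw [← hT, mul_sub, sub_mul,
      show S * (B₀ * C₁) = B₀ * C₁ * S by rw [← mul_assoc, hSB, mul_assoc, hSC, ← mul_assoc],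
      show S * (C₁ * B₀) = C₁ * B₀ * S by rw [← mul_assoc, hSC, mul_assoc, hSB, ← mul_assoc]]
  have hTfix : ∀ x, T x = x → x ∈ P := fun x hx => by
    have h := hPmem x
    rwa [hx, ← two_smul ℂ x, smul_smul, inv_mul_cancel₀ (two_ne_zero' ℂ), one_smul] at h
  have hTneg : ∀ x, T x = -x → x ∈ Q := fun x hx => by
    have h := hQmem x
    rwa [hx, sub_neg_eq_add, ← two_smul ℂ x, smul_smul, inv_mul_cancel₀ (two_ne_zero' ℂ), one_smul] at h
  refine ⟨fun p hp => hTfix _ ?_, fun q hq => hTneg _ ?_⟩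
  · have h := congrArg (fun f : Module.End ℂ M => f p) hST
    simp only [Module.End.mul_apply, hP p hp] at h
    exact h.symm
  · have h := congrArg (fun f : Module.End ℂ M => f q) hST
    simp only [Module.End.mul_apply, hQ q hq, map_neg] at h
    exact h.symm

/-- **`𝔰` acts irreducibly on `P`.** A subspace `U ⊆ P` stable under `𝔰 = {S ∈ 𝔊 : SB₀ = B₀S, SC₁ = C₁S}` is
`0` or `P`: an element of `𝔊` preserving `P` acts on `P` as its `𝔊₀`-component `yT + S` (§1), and the orbit
lemma (PART 1 `SymplecticThetaSix.eq_bot_or_eq_of_stable_le`) applies.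
[cite: MoonenZarhin1999LowDim, §2 (2.5)] [cite: Gordon1997, §6] -/
theorem SymplecticThetaSix.skeleton_irreducible (𝔊 : Submodule ℂ (Module.End ℂ M))
    (hbr : ∀ Y ∈ 𝔊, ∀ Z ∈ 𝔊, Y * Z - Z * Y ∈ 𝔊) {T : Module.End ℂ M} (hT𝔊 : T ∈ 𝔊) (hTT : ∀ v, T (T v) = v)
    {P Q : Submodule ℂ M} (hP : ∀ x ∈ P, T x = x) (hQ : ∀ x ∈ Q, T x = -x)
    (hPmem : ∀ v, (2 : ℂ)⁻¹ • (v + T v) ∈ P) (hQmem : ∀ v, (2 : ℂ)⁻¹ • (v - T v) ∈ Q)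
    (hirr : ∀ U : Submodule ℂ M, (∀ Z ∈ 𝔊, ∀ u ∈ U, Z u ∈ U) → U = ⊥ ∨ U = ⊤) (hPne : P ≠ ⊥)
    {B₀ C₁ : Module.End ℂ M} (hB₀𝔊 : B₀ ∈ 𝔊) (hB₀P : ∀ p ∈ P, B₀ p = 0) (hB₀im : ∀ v, B₀ v ∈ P)
    (hC₁𝔊 : C₁ ∈ 𝔊) (hC₁Q : ∀ q ∈ Q, C₁ q = 0) (hC₁im : ∀ v, C₁ v ∈ Q)
    (hBC : ∀ p ∈ P, B₀ (C₁ p) = p) (hCB : ∀ q ∈ Q, C₁ (B₀ q) = q)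
    (hlineS : ∀ B ∈ 𝔊, (∀ p ∈ P, B p = 0) → (∀ v, B v ∈ P) → ∃ c : ℂ, B = c • B₀)
    (hlineC : ∀ C ∈ 𝔊, (∀ q ∈ Q, C q = 0) → (∀ v, C v ∈ Q) → ∃ c : ℂ, C = c • C₁)
    (U : Submodule ℂ M) (hUP : U ≤ P)
    (hU : ∀ S ∈ 𝔊, S * B₀ = B₀ * S → S * C₁ = C₁ * S → ∀ u ∈ U, S u ∈ U) :
    U = ⊥ ∨ U = P := by
  have hPQ0 : ∀ x ∈ P, x ∈ Q → x = 0 := fun x hxP hxQ => by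
    have h1 := hP x hxP
    rw [hQ x hxQ, neg_eq_iff_add_eq_zero, ← two_smul ℂ x, smul_eq_zero] at h1
    exact h1.resolve_left (two_ne_zero' ℂ)
  refine SymplecticThetaSix.eq_bot_or_eq_of_stable_le 𝔊 hbr hT𝔊 hTT hP hQ hPmem hQmem hirr U hUP ?_
  intro Z hZ hZP u hu
  obtain ⟨Zm, -, Z0, hZ0, Zp, -, hZeq, hZpP, -, -, hZmim, -, -, hZ0P, hZ0Q⟩ :=
    SymplecticTheta.exists_decomp 𝔊 hbr hT𝔊 hTT hP hQ hPmem hQmem hZ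
  have huP := hUP hu
  have hZu : Z u = Z0 u := by
    have h1 : Z u = Zm u + Z0 u := by
      rw [hZeq, LinearMap.add_apply, LinearMap.add_apply, hZpP u huP, add_zero]
    have hZmu : Zm u = 0 := hPQ0 _ (by
      have h2 : Zm u = Z u - Z0 u := by rw [h1]; abel
      rw [h2]
      exact sub_mem (hZP u huP) (hZ0P u huP)) (hZmim u)
    rw [h1, hZmu, zero_add]
  obtain ⟨y, hS𝔊, hSB, hSC⟩ := SymplecticThetaSix.skeleton_levi 𝔊 hbr hP hQ hPmem hQmem hPne hB₀𝔊 hB₀P hB₀im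
    hC₁𝔊 hC₁Q hC₁im hBC hCB hlineS hlineC hZ0 hZ0P hZ0Q
  have e : Z0 u = (Z0 - y • T) u + y • u := by
    rw [LinearMap.sub_apply, LinearMap.smul_apply, hP u huP, sub_add_cancel]
  rw [hZu, e]
  exact add_mem (hU _ hS𝔊 hSB hSC u hu) (U.smul_mem y hu)

end Levi

/-! ### §2 A non-nilpotent element of `𝔰` (Engel's theorem) -/

section NonNilpotent

/-- **Some element of `𝔰` is not nilpotent on `P`** (`dim P = 3`). Otherwise the Lie algebra
`𝔰 = {S ∈ 𝔊 : SB₀ = B₀S, SC₁ = C₁S}` acts on `P` by nilpotent operators, so by ENGEL'S THEOREM (Mathlib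
`LieModule.isNilpotent_iff_forall'`, `LieModule.nontrivial_max_triv_of_isNilpotent`) it kills some `p₀ ≠ 0`
in `P`; the line `ℂp₀` is then `𝔰`-stable, contradicting §1 (`skeleton_irreducible`) as `dim P = 3`.
[cite: Humphreys1972, §3.3 (Engel's theorem)] [cite: MoonenZarhin1999LowDim, §2 (2.5)] -/
theorem SymplecticThetaSix.skeleton_exists_nonNilpotent [FiniteDimensional ℂ M]
    (𝔊 : Submodule ℂ (Module.End ℂ M))
    (hbr : ∀ Y ∈ 𝔊, ∀ Z ∈ 𝔊, Y * Z - Z * Y ∈ 𝔊) {T : Module.End ℂ M} (hT𝔊 : T ∈ 𝔊) (hTT : ∀ v, T (T v) = v)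
    {P Q : Submodule ℂ M} (hP : ∀ x ∈ P, T x = x) (hQ : ∀ x ∈ Q, T x = -x)
    (hPmem : ∀ v, (2 : ℂ)⁻¹ • (v + T v) ∈ P) (hQmem : ∀ v, (2 : ℂ)⁻¹ • (v - T v) ∈ Q)
    (hirr : ∀ U : Submodule ℂ M, (∀ Z ∈ 𝔊, ∀ u ∈ U, Z u ∈ U) → U = ⊥ ∨ U = ⊤)
    (hP3 : Module.finrank ℂ ↥P = 3)
    {B₀ C₁ : Module.End ℂ M} (hB₀𝔊 : B₀ ∈ 𝔊) (hB₀P : ∀ p ∈ P, B₀ p = 0) (hB₀im : ∀ v, B₀ v ∈ P)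
    (hC₁𝔊 : C₁ ∈ 𝔊) (hC₁Q : ∀ q ∈ Q, C₁ q = 0) (hC₁im : ∀ v, C₁ v ∈ Q)
    (hBC : ∀ p ∈ P, B₀ (C₁ p) = p) (hCB : ∀ q ∈ Q, C₁ (B₀ q) = q)
    (hlineS : ∀ B ∈ 𝔊, (∀ p ∈ P, B p = 0) → (∀ v, B v ∈ P) → ∃ c : ℂ, B = c • B₀)
    (hlineC : ∀ C ∈ 𝔊, (∀ q ∈ Q, C q = 0) → (∀ v, C v ∈ Q) → ∃ c : ℂ, C = c • C₁) :
    ∃ S ∈ 𝔊, S * B₀ = B₀ * S ∧ S * C₁ = C₁ * S ∧ ∃ p ∈ P, (S ^ 3) p ≠ 0 := by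
  classical
  letI : LieRing (Module.End ℂ M) := LieRing.ofAssociativeRing
  by_contra hcon
  push Not at hcon
  have hPne : P ≠ ⊥ := fun h => by
    rw [h, finrank_bot] at hP3
    exact absurd hP3 (by norm_num)
  -- the Lie subalgebra `𝔰`
  set 𝔰sub : Submodule ℂ (Module.End ℂ M) := 𝔊 ⊓
      LinearMap.ker (LinearMap.mulRight ℂ B₀ - LinearMap.mulLeft ℂ B₀) ⊓
      LinearMap.ker (LinearMap.mulRight ℂ C₁ - LinearMap.mulLeft ℂ C₁) with h𝔰sub
  have hmem𝔰 : ∀ S, S ∈ 𝔰sub ↔ S ∈ 𝔊 ∧ S * B₀ = B₀ * S ∧ S * C₁ = C₁ * S := fun S => by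
    simp only [h𝔰sub, Submodule.mem_inf, LinearMap.mem_ker, LinearMap.sub_apply, LinearMap.mulRight_apply,
      LinearMap.mulLeft_apply, sub_eq_zero, and_assoc]
  let L : LieSubalgebra ℂ (Module.End ℂ M) :=
    { 𝔰sub with
      lie_mem' := by
        intro S S' hS hS'
        change S ∈ 𝔰sub at hS
        change S' ∈ 𝔰sub at hS'
        change ⁅S, S'⁆ ∈ 𝔰sub
        rw [hmem𝔰] at hS hS' ⊢
        refine ⟨by rw [Ring.lie_def]; exact hbr S hS.1 S' hS'.1, ?_, ?_⟩
        · have e1 : S * S' * B₀ = B₀ * (S * S') := by rw [mul_assoc, hS'.2.1, ← mul_assoc, hS.2.1, mul_assoc]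
          have e2 : S' * S * B₀ = B₀ * (S' * S) := by rw [mul_assoc, hS.2.1, ← mul_assoc, hS'.2.1, mul_assoc]
          rw [Ring.lie_def, sub_mul, mul_sub, e1, e2]
        · have e1 : S * S' * C₁ = C₁ * (S * S') := by rw [mul_assoc, hS'.2.2, ← mul_assoc, hS.2.2, mul_assoc]
          have e2 : S' * S * C₁ = C₁ * (S' * S) := by rw [mul_assoc, hS.2.2, ← mul_assoc, hS'.2.2, mul_assoc]
          rw [Ring.lie_def, sub_mul, mul_sub, e1, e2] }
  have hmemL : ∀ S, S ∈ L ↔ S ∈ 𝔊 ∧ S * B₀ = B₀ * S ∧ S * C₁ = C₁ * S := fun S => hmem𝔰 S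
  -- `P` as a Lie submodule over `𝔰`
  have hLP : ∀ S : L, ∀ p ∈ P, (S : Module.End ℂ M) p ∈ P := fun S p hp =>
    (SymplecticThetaSix.skeleton_mapsTo hP hQ hPmem hQmem hB₀P hC₁Q hBC hCB ((hmemL _).1 S.2).2.1
      ((hmemL _).1 S.2).2.2).1 p hp
  let PL : LieSubmodule ℂ L M :=
    { (P : Submodule ℂ M) with
      lie_mem := by
        intro S m hm
        change m ∈ P at hm
        change ⁅S, m⁆ ∈ P
        rw [LieSubalgebra.coe_bracket_of_module, Module.End.lie_apply]
        exact hLP S m hm }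
  have hmemPL : ∀ m, m ∈ PL ↔ m ∈ P := fun m => Iff.rfl
  -- every element of `𝔰` is nilpotent on `P`
  have hnil : ∀ S : L, _root_.IsNilpotent (LieModule.toEnd ℂ L PL S) := by
    intro S
    refine ⟨3, LinearMap.ext fun m => Subtype.ext ?_⟩
    have h := hcon S ((hmemL _).1 S.2).1 ((hmemL _).1 S.2).2.1 ((hmemL _).1 S.2).2.2 m m.2
    rw [pow_three, Module.End.mul_apply, Module.End.mul_apply] at h
    rw [pow_three, Module.End.mul_apply, Module.End.mul_apply, LinearMap.zero_apply]
    simp only [LieModule.toEnd_apply_apply, LieSubmodule.coe_bracket, LieSubalgebra.coe_bracket_of_module,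
      Module.End.lie_apply, LieSubmodule.coe_zero]
    exact h
  haveI : LieModule.IsNilpotent L PL := (LieModule.isNilpotent_iff_forall' (R := ℂ)).2 hnil
  haveI : Nontrivial PL := by
    obtain ⟨p, hp, hp0⟩ := (Submodule.ne_bot_iff P).1 hPne
    exact ⟨⟨⟨p, hp⟩, 0, fun h => hp0 (congrArg Subtype.val h)⟩⟩
  haveI := LieModule.nontrivial_max_triv_of_isNilpotent ℂ L PL
  obtain ⟨x, hx0⟩ := exists_ne (0 : ↥(LieModule.maxTrivSubmodule ℂ L PL))
  set p₀ : M := ((x : PL) : M) with hp₀def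
  have hp₀P : p₀ ∈ P := (x : PL).2
  have hp₀0 : p₀ ≠ 0 := fun h => hx0 (Subtype.ext (Subtype.ext h))
  have hxtriv := (LieModule.mem_maxTrivSubmodule ℂ L PL (x : PL)).1 x.2
  have hkill : ∀ S ∈ 𝔊, S * B₀ = B₀ * S → S * C₁ = C₁ * S → S p₀ = 0 := by
    intro S hS hSB hSC
    have h := congrArg (fun m : PL => (m : M)) (hxtriv ⟨S, (hmemL S).2 ⟨hS, hSB, hSC⟩⟩)
    simpa [LieSubmodule.coe_bracket, LieSubalgebra.coe_bracket_of_module] using h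
  -- the line `ℂ p₀` is `𝔰`-stable
  rcases SymplecticThetaSix.skeleton_irreducible 𝔊 hbr hT𝔊 hTT hP hQ hPmem hQmem hirr hPne hB₀𝔊 hB₀P hB₀im
      hC₁𝔊 hC₁Q hC₁im hBC hCB hlineS hlineC (ℂ ∙ p₀)
      (by rw [Submodule.span_singleton_le_iff_mem]; exact hp₀P)
      (fun S hS hSB hSC u hu => by
        obtain ⟨c, rfl⟩ := Submodule.mem_span_singleton.1 hu
        rw [map_smul, hkill S hS hSB hSC, smul_zero]
        exact zero_mem _) with h | h
  · exact hp₀0 (by rw [← Submodule.mem_bot ℂ, ← h]; exact Submodule.mem_span_singleton_self p₀)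
  · have h1 := finrank_span_singleton (K := ℂ) hp₀0
    rw [h, hP3] at h1
    exact absurd h1 (by norm_num)

end NonNilpotent

/-! ### §3 The spectral structure of a non-nilpotent element of `𝔰` -/

section Spectral

/-- **Spectral structure of a non-nilpotent `S ∈ 𝔰`** (`dim P = 3`). For the symmetric form
`s(x, y) = ω(x, C₁y)` (nondegenerate on `P`, and `s(Sx, y) = −s(x, Sy)` for `S ∈ 𝔰`), a non-nilpotent `S ∈ 𝔰`
has eigenvectors `p₊, p₀, p₋ ∈ P` with eigenvalues `e, 0, −e` (`e ≠ 0`) such that `s(p₊,p₊) = s(p₋,p₋) = 0`,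
`s(p₀, p_±) = 0`, `s(p₊, p₋) ≠ 0 ≠ s(p₀, p₀)`. Proof: an eigenvalue `e ≠ 0` exists (else `S|_P` is nilpotent,
PART 2b `exists_cube_eq_zero_of_eigenvalue`); `−e` is an eigenvalue since `s(p₊, (S + e)P) = 0`; a third basis
vector `w` has `Sw = ap₊ + bp₋ + cw` and `s(p₊, p₋) = 0` would force `c = −e` and `c = e`; the `s`-orthogonal
projection `p₀` of `w` is then killed by `S` (`2c′s(p₀,p₀) = 0`). (The regular semisimple element of
`𝔰 ≅ 𝔰𝔬(P, s) ≅ 𝔰𝔬₃`.) [cite: Humphreys1972, §8.1] [cite: MoonenZarhin1999LowDim, §2 (2.5)] -/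
theorem SymplecticThetaSix.skeleton_spectral [FiniteDimensional ℂ M] (ω : LinearMap.BilinForm ℂ M)
    (hωnd : ω.Nondegenerate) (hωalt : ∀ x y, ω x y = -ω y x) (𝔊 : Submodule ℂ (Module.End ℂ M))
    (hskew : ∀ Z ∈ 𝔊, ∀ x y, ω (Z x) y + ω x (Z y) = 0)
    {T : Module.End ℂ M} (hT𝔊 : T ∈ 𝔊) {P Q : Submodule ℂ M} (hP : ∀ x ∈ P, T x = x) (hQ : ∀ x ∈ Q, T x = -x)
    (hPmem : ∀ v, (2 : ℂ)⁻¹ • (v + T v) ∈ P) (hQmem : ∀ v, (2 : ℂ)⁻¹ • (v - T v) ∈ Q)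
    (hP3 : Module.finrank ℂ ↥P = 3)
    {B₀ C₁ : Module.End ℂ M} (hB₀P : ∀ p ∈ P, B₀ p = 0) (hB₀im : ∀ v, B₀ v ∈ P)
    (hC₁𝔊 : C₁ ∈ 𝔊) (hC₁Q : ∀ q ∈ Q, C₁ q = 0)
    (hBC : ∀ p ∈ P, B₀ (C₁ p) = p) (hCB : ∀ q ∈ Q, C₁ (B₀ q) = q)
    {S : Module.End ℂ M} (hS𝔊 : S ∈ 𝔊) (hSB : S * B₀ = B₀ * S) (hSC : S * C₁ = C₁ * S)
    (hS3 : ∃ p ∈ P, (S ^ 3) p ≠ 0) :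
    ∃ e : ℂ, e ≠ 0 ∧ ∃ pu ∈ P, ∃ pz ∈ P, ∃ pd ∈ P, pu ≠ 0 ∧ pz ≠ 0 ∧ pd ≠ 0 ∧
      S pu = e • pu ∧ S pz = 0 ∧ S pd = (-e) • pd ∧
      ω pu (C₁ pu) = 0 ∧ ω pd (C₁ pd) = 0 ∧ ω pz (C₁ pu) = 0 ∧ ω pz (C₁ pd) = 0 ∧
      ω pu (C₁ pd) ≠ 0 ∧ ω pz (C₁ pz) ≠ 0 := by
  classical
  -- basic facts
  have hPQv : ∀ v, (2 : ℂ)⁻¹ • (v + T v) + (2 : ℂ)⁻¹ • (v - T v) = v := fun v => by module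
  have hPiso : ∀ x ∈ P, ∀ y ∈ P, ω x y = 0 := fun x hx y hy => by
    have h := hskew T hT𝔊 x y
    rw [hP x hx, hP y hy] at h
    exact add_self_eq_zero.1 h
  have hdetP : ∀ x ∈ P, (∀ q ∈ Q, ω x q = 0) → x = 0 := fun x hx h =>
    hωnd.1 x fun y => by
      rw [← hPQv y, map_add, hPiso x hx _ (hPmem y), h _ (hQmem y), add_zero]
  -- the form `s(x, y) = ω(x, C₁ y)`
  have hsym : ∀ x y, ω x (C₁ y) = ω y (C₁ x) := fun x y => by
    have h := hskew C₁ hC₁𝔊 y x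
    rw [hωalt (C₁ y) x] at h
    linear_combination -h
  have hsS : ∀ x y, ω (S x) (C₁ y) = -ω x (C₁ (S y)) := fun x y => by
    have h := hskew S hS𝔊 x (C₁ y)
    rw [← Module.End.mul_apply, hSC, Module.End.mul_apply] at h
    linear_combination h
  have hsnd : ∀ p ∈ P, (∀ p' ∈ P, ω p (C₁ p') = 0) → p = 0 := fun p hp h =>
    hdetP p hp fun q hq => by rw [← hCB q hq]; exact h _ (hB₀im q)
  have hSP : ∀ p ∈ P, S p ∈ P :=
    (SymplecticThetaSix.skeleton_mapsTo hP hQ hPmem hQmem hB₀P hC₁Q hBC hCB hSB hSC).1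
  haveI : Nontrivial ↥P := Module.nontrivial_of_finrank_pos (R := ℂ) (by rw [hP3]; norm_num)
  set Xr := S.restrict hSP with hXr
  have hXrcoe : ∀ y : ↥P, ((Xr y : ↥P) : M) = S y := fun y => by rw [hXr, LinearMap.coe_restrict_apply]
  -- (1) an eigenvalue `e ≠ 0`
  obtain ⟨e, he, vu, hvu0, hvu⟩ : ∃ μ : ℂ, μ ≠ 0 ∧ ∃ v : ↥P, v ≠ 0 ∧ Xr v = μ • v := by
    by_contra hno
    push Not at hno
    obtain ⟨t, ht3⟩ := SymplecticThetaSix.exists_cube_eq_zero_of_eigenvalue hP3 Xr (by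
      intro μ₁ μ₂ v₁ v₂ hv₁ h1 hv₂ h2
      have h1' : μ₁ = 0 := by
        by_contra hμ
        exact hno μ₁ hμ v₁ hv₁ h1
      have h2' : μ₂ = 0 := by
        by_contra hμ
        exact hno μ₂ hμ v₂ hv₂ h2
      rw [h1', h2'])
    have ht0 : t = 0 := by
      by_contra ht
      have hinj : Function.Injective (Xr - t • (1 : Module.End ℂ ↥P)) := by
        rw [← LinearMap.ker_eq_bot, LinearMap.ker_eq_bot']
        intro v hv
        by_contra hv0
        rw [LinearMap.sub_apply, LinearMap.smul_apply, Module.End.one_apply, sub_eq_zero] at hv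
        exact hno t ht v hv0 hv
      obtain ⟨v, hv⟩ := exists_ne (0 : ↥P)
      apply hv
      have h3 : ((Xr - t • (1 : Module.End ℂ ↥P)) ^ 3) v = ((Xr - t • (1 : Module.End ℂ ↥P)) ^ 3) 0 := by
        rw [ht3, LinearMap.zero_apply, LinearMap.zero_apply]
      rw [Module.End.coe_pow] at h3
      exact hinj.iterate 3 h3
    rw [ht0, zero_smul, sub_zero] at ht3
    obtain ⟨p, hp, hp3⟩ := hS3
    apply hp3
    have h := congrArg Subtype.val (LinearMap.congr_fun ht3 ⟨p, hp⟩)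
    rw [pow_three, Module.End.mul_apply, Module.End.mul_apply, hXrcoe, hXrcoe, hXrcoe, LinearMap.zero_apply,
      Submodule.coe_zero] at h
    rw [pow_three, Module.End.mul_apply, Module.End.mul_apply]
    exact h
  set pu : M := (vu : M) with hpudef
  have hpuP : pu ∈ P := vu.2
  have hpu0 : pu ≠ 0 := fun h => hvu0 (Subtype.ext h)
  have hSpu : S pu = e • pu := by
    have h := congrArg Subtype.val hvu
    rwa [hXrcoe, Submodule.coe_smul] at h
  have hfu : ∀ y, ω pu (C₁ (S y)) = -(e * ω pu (C₁ y)) := fun y => by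
    have h := hsS pu y
    rw [hSpu, map_smul, LinearMap.smul_apply, smul_eq_mul] at h
    linear_combination h
  -- (2) `-e` is an eigenvalue
  obtain ⟨vd, hvd0, hvd⟩ : ∃ v : ↥P, v ≠ 0 ∧ Xr v = (-e) • v := by
    by_contra hno
    push Not at hno
    have hinj : Function.Injective (Xr + e • (1 : Module.End ℂ ↥P)) := by
      rw [← LinearMap.ker_eq_bot, LinearMap.ker_eq_bot']
      intro v hv
      by_contra hv0
      rw [LinearMap.add_apply, LinearMap.smul_apply, Module.End.one_apply, add_eq_zero_iff_eq_neg, ← neg_smul]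
        at hv
      exact hno v hv0 hv
    have hsurj := LinearMap.injective_iff_surjective.1 hinj
    apply hpu0
    refine hsnd pu hpuP fun p' hp' => ?_
    obtain ⟨y, hy⟩ := hsurj ⟨p', hp'⟩
    have hy' : p' = S y + e • (y : M) := by
      have h := congrArg Subtype.val hy
      rw [LinearMap.add_apply, LinearMap.smul_apply, Module.End.one_apply, Submodule.coe_add, Submodule.coe_smul,
        hXrcoe] at h
      exact h.symm
    rw [hy', map_add, map_smul, map_add, map_smul, smul_eq_mul, hfu]
    ring
  set pd : M := (vd : M) with hpddef
  have hpdP : pd ∈ P := vd.2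
  have hpd0 : pd ≠ 0 := fun h => hvd0 (Subtype.ext h)
  have hSpd : S pd = (-e) • pd := by
    have h := congrArg Subtype.val hvd
    rwa [hXrcoe, Submodule.coe_smul] at h
  have hfd : ∀ y, ω pd (C₁ (S y)) = e * ω pd (C₁ y) := fun y => by
    have h := hsS pd y
    rw [hSpd, map_smul, LinearMap.smul_apply, smul_eq_mul] at h
    linear_combination h
  -- isotropy of the eigenvectors
  have hsuu : ω pu (C₁ pu) = 0 := by
    have h := hfu pu
    rw [hSpu, map_smul, map_smul, smul_eq_mul] at h
    have h2 : (2 * e) * ω pu (C₁ pu) = 0 := by linear_combination h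
    exact (mul_eq_zero.1 h2).resolve_left (mul_ne_zero two_ne_zero he)
  have hsdd : ω pd (C₁ pd) = 0 := by
    have h := hfd pd
    rw [hSpd, map_smul, map_smul, smul_eq_mul] at h
    have h2 : (2 * e) * ω pd (C₁ pd) = 0 := by linear_combination -h
    exact (mul_eq_zero.1 h2).resolve_left (mul_ne_zero two_ne_zero he)
  -- (3) a third basis vector `w` and coordinates
  have hpair : ∀ w ∈ P, w ∉ Submodule.span ℂ {pu, pd} →
      ∀ y ∈ P, ∃ a b c : ℂ, y = a • pu + b • pd + c • w := by
    intro w hwP hw y hy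
    have hli : LinearIndependent ℂ ![pu, pd, w] := by
      rw [Fintype.linearIndependent_iff]
      intro g hg
      rw [Fin.sum_univ_three] at hg
      simp only [Matrix.cons_val_zero, Matrix.cons_val_one, Matrix.cons_val_two, Matrix.tail_cons,
        Matrix.head_cons] at hg
      have hg2 : g 2 = 0 := by
        by_contra h2
        apply hw
        have e2 : g 2 • w = -(g 0 • pu + g 1 • pd) := by rw [eq_neg_iff_add_eq_zero, add_comm]; exact hg
        have e1 : w = -(g 2)⁻¹ • (g 0 • pu + g 1 • pd) := by
          have h3 : w = (g 2)⁻¹ • (g 2 • w) := by rw [smul_smul, inv_mul_cancel₀ h2, one_smul]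
          rw [h3, e2, smul_neg, neg_smul]
        rw [Submodule.mem_span_pair]
        exact ⟨-(g 2)⁻¹ * g 0, -(g 2)⁻¹ * g 1, by rw [e1, smul_add, smul_smul, smul_smul]⟩
      rw [hg2, zero_smul, add_zero] at hg
      have hS := congrArg (fun x => S x) hg
      simp only [map_add, map_smul, hSpu, hSpd, map_zero, smul_smul] at hS
      have hg0 : g 0 = 0 := by
        have e1 : (2 * e * g 0) • pu = 0 := by
          have e2 : (2 * e * g 0) • pu = e • (g 0 • pu + g 1 • pd) + ((g 0 * e) • pu + (g 1 * -e) • pd) := by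
            module
          rw [e2, hg, hS, smul_zero, add_zero]
        have := (smul_eq_zero.1 e1).resolve_right hpu0
        exact (mul_eq_zero.1 this).resolve_left (mul_ne_zero two_ne_zero he)
      rw [hg0, zero_smul, zero_add] at hg
      have hg1 : g 1 = 0 := (smul_eq_zero.1 hg).resolve_right hpd0
      intro i
      fin_cases i <;> assumption
    have hle : Submodule.span ℂ (Set.range ![pu, pd, w]) ≤ P := by
      rw [Submodule.span_le]
      rintro _ ⟨i, rfl⟩
      fin_cases i
      · exact hpuP
      · exact hpdP
      · exact hwP
    have heq : Submodule.span ℂ (Set.range ![pu, pd, w]) = P :=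
      Submodule.eq_of_le_of_finrank_eq hle (by rw [finrank_span_eq_card hli, hP3]; simp)
    have hy' : y ∈ Submodule.span ℂ (Set.range ![pu, pd, w]) := by rw [heq]; exact hy
    obtain ⟨c, hc⟩ := (Submodule.mem_span_range_iff_exists_fun ℂ).1 hy'
    refine ⟨c 0, c 1, c 2, ?_⟩
    rw [← hc, Fin.sum_univ_three]
    simp
  have hspan2 : Module.finrank ℂ (Submodule.span ℂ ({pu, pd} : Set M)) ≤ 2 := by
    rw [Submodule.span_insert]
    refine (Submodule.finrank_add_le_finrank_add_finrank _ _).trans ?_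
    rw [finrank_span_singleton hpu0, finrank_span_singleton hpd0]
  obtain ⟨w, hwP, hw⟩ : ∃ w ∈ P, w ∉ Submodule.span ℂ ({pu, pd} : Set M) := by
    by_contra h
    push Not at h
    have hle : P ≤ Submodule.span ℂ ({pu, pd} : Set M) := h
    have := Submodule.finrank_mono hle
    rw [hP3] at this
    omega
  -- (4) `σ = s(pu, pd) ≠ 0`
  have hσ : ω pu (C₁ pd) ≠ 0 := by
    intro hσ
    have hσ' : ω pd (C₁ pu) = 0 := by rw [hsym]; exact hσ
    obtain ⟨a, b, c, habc⟩ := hpair w hwP hw (S w) (hSP w hwP)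
    -- `s(pu, w) ≠ 0` and `s(pd, w) ≠ 0`
    have hneu : ω pu (C₁ w) ≠ 0 := by
      intro h0
      apply hpu0
      refine hsnd pu hpuP fun y hy => ?_
      obtain ⟨a', b', c', rfl⟩ := hpair w hwP hw y hy
      simp only [map_add, map_smul, smul_eq_mul, hsuu, hσ, h0, mul_zero, add_zero]
    have hned : ω pd (C₁ w) ≠ 0 := by
      intro h0
      apply hpd0
      refine hsnd pd hpdP fun y hy => ?_
      obtain ⟨a', b', c', rfl⟩ := hpair w hwP hw y hy
      simp only [map_add, map_smul, smul_eq_mul, hsdd, hσ', h0, mul_zero, add_zero]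
    have h1 := hfu w
    rw [habc] at h1
    simp only [map_add, map_smul, smul_eq_mul, hsuu, hσ, mul_zero, zero_add] at h1
    have hc1 : (c + e) * ω pu (C₁ w) = 0 := by linear_combination h1
    have hc1' := (mul_eq_zero.1 hc1).resolve_right hneu
    have h2 := hfd w
    rw [habc] at h2
    simp only [map_add, map_smul, smul_eq_mul, hsdd, hσ', mul_zero, zero_add, add_zero] at h2
    have hc2 : (c - e) * ω pd (C₁ w) = 0 := by linear_combination h2
    have hc2' := (mul_eq_zero.1 hc2).resolve_right hned
    apply he
    linear_combination (hc1' - hc2') / 2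
  -- (5) the `s`-orthogonal projection `pz` of `w`
  set σ := ω pu (C₁ pd) with hσdef
  have hσ' : ω pd (C₁ pu) = σ := by rw [hsym]
  set pz : M := w - (σ⁻¹ * ω w (C₁ pd)) • pu - (σ⁻¹ * ω w (C₁ pu)) • pd with hpzdef
  have hpzP : pz ∈ P := sub_mem (sub_mem hwP (P.smul_mem _ hpuP)) (P.smul_mem _ hpdP)
  have hpz0 : pz ≠ 0 := by
    intro h
    apply hw
    rw [Submodule.mem_span_pair]
    refine ⟨σ⁻¹ * ω w (C₁ pd), σ⁻¹ * ω w (C₁ pu), ?_⟩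
    rw [hpzdef, sub_sub, sub_eq_zero] at h
    exact h.symm
  have hwz : w = pz + (σ⁻¹ * ω w (C₁ pd)) • pu + (σ⁻¹ * ω w (C₁ pu)) • pd := by
    rw [hpzdef]; abel
  have hzu : ω pz (C₁ pu) = 0 := by
    have e1 : ω pz (C₁ pu) = ω w (C₁ pu) - (σ⁻¹ * ω w (C₁ pd)) * ω pu (C₁ pu) -
        (σ⁻¹ * ω w (C₁ pu)) * ω pd (C₁ pu) := by
      rw [hpzdef]
      simp only [map_sub, map_smul, LinearMap.sub_apply, LinearMap.smul_apply, smul_eq_mul]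
    rw [e1, hsuu, hσ', mul_zero, sub_zero, mul_assoc, mul_comm (ω w (C₁ pu)) σ, ← mul_assoc,
      inv_mul_cancel₀ hσ, one_mul, sub_self]
  have hzd : ω pz (C₁ pd) = 0 := by
    have e1 : ω pz (C₁ pd) = ω w (C₁ pd) - (σ⁻¹ * ω w (C₁ pd)) * ω pu (C₁ pd) -
        (σ⁻¹ * ω w (C₁ pu)) * ω pd (C₁ pd) := by
      rw [hpzdef]
      simp only [map_sub, map_smul, LinearMap.sub_apply, LinearMap.smul_apply, smul_eq_mul]
    rw [e1, hsdd, mul_zero, sub_zero, mul_assoc, mul_comm (ω w (C₁ pd)) σ, ← mul_assoc,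
      inv_mul_cancel₀ hσ, one_mul, sub_self]
  have huz : ω pu (C₁ pz) = 0 := by rw [hsym]; exact hzu
  have hdz : ω pd (C₁ pz) = 0 := by rw [hsym]; exact hzd
  have hpzspan : pz ∉ Submodule.span ℂ ({pu, pd} : Set M) := by
    intro h
    apply hw
    rw [hwz]
    refine add_mem (add_mem h (Submodule.smul_mem _ _ (Submodule.subset_span (by simp)))) ?_
    exact Submodule.smul_mem _ _ (Submodule.subset_span (by simp))
  -- (6) `S pz = 0` and `s(pz, pz) ≠ 0`
  have hτ : ω pz (C₁ pz) ≠ 0 := by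
    intro h0
    apply hpz0
    refine hsnd pz hpzP fun y hy => ?_
    obtain ⟨a', b', c', rfl⟩ := hpair pz hpzP hpzspan y hy
    simp only [map_add, map_smul, smul_eq_mul, hzu, hzd, h0, mul_zero, add_zero]
  have hSpz : S pz = 0 := by
    obtain ⟨a, b, c, habc⟩ := hpair pz hpzP hpzspan (S pz) (hSP pz hpzP)
    have h1 := hfu pz
    rw [habc, huz] at h1
    simp only [map_add, map_smul, smul_eq_mul, hsuu, huz, mul_zero, zero_add, add_zero, neg_zero] at h1
    have hb : b = 0 := (mul_eq_zero.1 h1).resolve_right hσ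
    have h2 := hfd pz
    rw [habc, hdz] at h2
    simp only [map_add, map_smul, smul_eq_mul, hsdd, hσ', hdz, mul_zero, add_zero] at h2
    have ha : a = 0 := (mul_eq_zero.1 h2).resolve_right hσ
    rw [ha, hb, zero_smul, zero_smul, zero_add, zero_add] at habc
    have h3 := hsS pz pz
    simp only [habc, map_smul, LinearMap.smul_apply, smul_eq_mul] at h3
    have hc : (2 * ω pz (C₁ pz)) * c = 0 := by linear_combination h3
    have hc' : c = 0 := (mul_eq_zero.1 hc).resolve_left (mul_ne_zero two_ne_zero hτ)
    rw [habc, hc', zero_smul]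
  exact ⟨e, he, pu, hpuP, pz, hpzP, pd, hpdP, hpu0, hpz0, hpd0, hSpu, hSpz, hSpd, hsuu, hsdd, hzu, hzd, hσ,
    hτ⟩

end Spectral

/-! ### §4 The `𝔰𝔩₂`-triple: `𝔰 = ⟨S, E′, F′⟩ = 𝔰𝔬(P, s)` -/

section Triple

/-- **`𝔰 = ⟨S, E′, F′⟩ ≅ 𝔰𝔬(P, s) ≅ 𝔰𝔩₂`.** With `S ∈ 𝔰` and its eigenbasis `p₊, p₀, p₋` of `P` (§3; `σ = s(p₊,p₋)`,
`τ = s(p₀,p₀)`), the `s`-skewness of the elements of `𝔰` leaves three free matrix coefficients, and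
`E′ = (2e²a)⁻¹((ad S)² + e·ad S)S₁`, `F′ = (2e²b)⁻¹((ad S)² − e·ad S)S₂ ∈ 𝔰` (for `S₁, S₂ ∈ 𝔰` moving `p₀` off
`⟨p₀, p₋⟩`, resp. `p₊` off `ℂp₊`, which exist by irreducibility) act by `E′p₊ = 0`, `E′p₀ = p₊`,
`E′p₋ = −(σ/τ)p₀`, `F′p₊ = p₀`, `F′p₀ = −(τ/σ)p₋`, `F′p₋ = 0`; every element of `𝔰` is a combination of
`S, E′, F′`, and `[S, E′] = eE′`, `[S, F′] = −eF′`, `[E′, F′] = e⁻¹S` (an element of `𝔰` vanishing on `P`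
vanishes, by `ω`-duality). [cite: Humphreys1972, §7.1–§7.2] [cite: MoonenZarhin1999LowDim, §2 (2.5)] -/
theorem SymplecticThetaSix.skeleton_triple [FiniteDimensional ℂ M] (ω : LinearMap.BilinForm ℂ M)
    (hωnd : ω.Nondegenerate) (hωalt : ∀ x y, ω x y = -ω y x) (𝔊 : Submodule ℂ (Module.End ℂ M))
    (hbr : ∀ Y ∈ 𝔊, ∀ Z ∈ 𝔊, Y * Z - Z * Y ∈ 𝔊) (hskew : ∀ Z ∈ 𝔊, ∀ x y, ω (Z x) y + ω x (Z y) = 0)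
    {T : Module.End ℂ M} (hT𝔊 : T ∈ 𝔊) (hTT : ∀ v, T (T v) = v) {P Q : Submodule ℂ M}
    (hP : ∀ x ∈ P, T x = x) (hQ : ∀ x ∈ Q, T x = -x) (hPmem : ∀ v, (2 : ℂ)⁻¹ • (v + T v) ∈ P)
    (hQmem : ∀ v, (2 : ℂ)⁻¹ • (v - T v) ∈ Q)
    (hirr : ∀ U : Submodule ℂ M, (∀ Z ∈ 𝔊, ∀ u ∈ U, Z u ∈ U) → U = ⊥ ∨ U = ⊤)
    (hP3 : Module.finrank ℂ ↥P = 3)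
    {B₀ C₁ : Module.End ℂ M} (hB₀𝔊 : B₀ ∈ 𝔊) (hB₀P : ∀ p ∈ P, B₀ p = 0) (hB₀im : ∀ v, B₀ v ∈ P)
    (hC₁𝔊 : C₁ ∈ 𝔊) (hC₁Q : ∀ q ∈ Q, C₁ q = 0) (hC₁im : ∀ v, C₁ v ∈ Q)
    (hBC : ∀ p ∈ P, B₀ (C₁ p) = p) (hCB : ∀ q ∈ Q, C₁ (B₀ q) = q)
    (hlineS : ∀ B ∈ 𝔊, (∀ p ∈ P, B p = 0) → (∀ v, B v ∈ P) → ∃ c : ℂ, B = c • B₀)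
    (hlineC : ∀ C ∈ 𝔊, (∀ q ∈ Q, C q = 0) → (∀ v, C v ∈ Q) → ∃ c : ℂ, C = c • C₁)
    {S : Module.End ℂ M} (hS𝔊 : S ∈ 𝔊) (hSB : S * B₀ = B₀ * S) (hSC : S * C₁ = C₁ * S)
    {e : ℂ} (he : e ≠ 0) {pu pz pd : M} (hpuP : pu ∈ P) (hpzP : pz ∈ P) (hpdP : pd ∈ P)
    (hpu0 : pu ≠ 0) (hpz0 : pz ≠ 0) (hpd0 : pd ≠ 0)
    (hSpu : S pu = e • pu) (hSpz : S pz = 0) (hSpd : S pd = (-e) • pd)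
    (hsuu : ω pu (C₁ pu) = 0) (hsdd : ω pd (C₁ pd) = 0) (hzu : ω pz (C₁ pu) = 0) (hzd : ω pz (C₁ pd) = 0)
    (hσ : ω pu (C₁ pd) ≠ 0) (hτ : ω pz (C₁ pz) ≠ 0) :
    ∃ E' ∈ 𝔊, ∃ F' ∈ 𝔊, E' * B₀ = B₀ * E' ∧ E' * C₁ = C₁ * E' ∧ F' * B₀ = B₀ * F' ∧ F' * C₁ = C₁ * F' ∧
      E' pu = 0 ∧ E' pz = pu ∧ E' pd = -((ω pu (C₁ pd)) * (ω pz (C₁ pz))⁻¹) • pz ∧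
      F' pu = pz ∧ F' pz = -((ω pz (C₁ pz)) * (ω pu (C₁ pd))⁻¹) • pd ∧ F' pd = 0 ∧
      (∀ S' ∈ 𝔊, S' * B₀ = B₀ * S' → S' * C₁ = C₁ * S' → ∃ x y z : ℂ, S' = x • S + y • E' + z • F') ∧
      S * E' - E' * S = e • E' ∧ S * F' - F' * S = -(e • F') ∧ E' * F' - F' * E' = e⁻¹ • S := by
  classical
  -- basic facts
  have hPQv : ∀ v, (2 : ℂ)⁻¹ • (v + T v) + (2 : ℂ)⁻¹ • (v - T v) = v := fun v => by module
  have hPiso : ∀ x ∈ P, ∀ y ∈ P, ω x y = 0 := fun x hx y hy => by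
    have h := hskew T hT𝔊 x y
    rw [hP x hx, hP y hy] at h
    exact add_self_eq_zero.1 h
  have hQiso : ∀ x ∈ Q, ∀ y ∈ Q, ω x y = 0 := fun x hx y hy => by
    have h := hskew T hT𝔊 x y
    rw [hQ x hx, hQ y hy, map_neg, LinearMap.neg_apply, map_neg, ← neg_add, neg_eq_zero, add_self_eq_zero] at h
    exact h
  have hdetQ : ∀ y ∈ Q, (∀ p ∈ P, ω p y = 0) → y = 0 := fun y hy h =>
    hωnd.2 y fun x => by
      rw [← hPQv x, map_add, LinearMap.add_apply, h _ (hPmem x), hQiso _ (hQmem x) y hy, add_zero]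
  set σ := ω pu (C₁ pd) with hσdef
  set τ := ω pz (C₁ pz) with hτdef
  have hsym : ∀ x y, ω x (C₁ y) = ω y (C₁ x) := fun x y => by
    have h := hskew C₁ hC₁𝔊 y x
    rw [hωalt (C₁ y) x] at h
    linear_combination -h
  have hσ' : ω pd (C₁ pu) = σ := by rw [hsym]
  have huz : ω pu (C₁ pz) = 0 := by rw [hsym]; exact hzu
  have hdz : ω pd (C₁ pz) = 0 := by rw [hsym]; exact hzd
  have heinv : e * e⁻¹ = 1 := mul_inv_cancel₀ he
  have hσinv : σ * σ⁻¹ = 1 := mul_inv_cancel₀ hσ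
  have hτinv : τ * τ⁻¹ = 1 := mul_inv_cancel₀ hτ
  -- elements of `𝔰`: preserve `P`, `Q`; are `s`-skew; vanish if they vanish on `P`
  have h𝔰PQ : ∀ S' : Module.End ℂ M, S' * B₀ = B₀ * S' → S' * C₁ = C₁ * S' →
      (∀ p ∈ P, S' p ∈ P) ∧ (∀ q ∈ Q, S' q ∈ Q) := fun S' h1 h2 =>
    SymplecticThetaSix.skeleton_mapsTo hP hQ hPmem hQmem hB₀P hC₁Q hBC hCB h1 h2
  have hsk : ∀ S' ∈ 𝔊, S' * C₁ = C₁ * S' → ∀ x y, ω (S' x) (C₁ y) = -ω x (C₁ (S' y)) :=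
    fun S' hS' hS'C x y => by
      have h := hskew S' hS' x (C₁ y)
      rw [← Module.End.mul_apply, hS'C, Module.End.mul_apply] at h
      linear_combination h
  have hinj : ∀ Z ∈ 𝔊, (∀ q ∈ Q, Z q ∈ Q) → (∀ p ∈ P, Z p = 0) → Z = 0 := by
    intro Z hZ hZQ hZP
    ext v
    rw [← hPQv v, map_add, hZP _ (hPmem v), zero_add, LinearMap.zero_apply]
    refine hdetQ _ (hZQ _ (hQmem v)) fun p hp => ?_
    have h := hskew Z hZ p ((2 : ℂ)⁻¹ • (v - T v))
    rw [hZP p hp, map_zero, LinearMap.zero_apply, zero_add] at h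
    exact h
  -- coordinates with respect to the eigenbasis `pu, pz, pd`
  have hcoord : ∀ y ∈ P, ∃ a b c : ℂ, y = a • pu + b • pz + c • pd := by
    have hli : LinearIndependent ℂ ![pu, pz, pd] := by
      rw [Fintype.linearIndependent_iff]
      intro g hg
      rw [Fin.sum_univ_three] at hg
      simp only [Matrix.cons_val_zero, Matrix.cons_val_one, Matrix.cons_val_two, Matrix.tail_cons,
        Matrix.head_cons] at hg
      have hB := congrArg (fun x => S x) hg
      simp only [map_add, map_smul, hSpu, hSpz, hSpd, map_zero, smul_zero, add_zero, smul_smul] at hB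
      have hC := congrArg (fun x => S x) hB
      simp only [map_add, map_smul, hSpu, hSpd, map_zero, smul_smul] at hC
      have hg0 : g 0 = 0 := by
        have e1 : (2 * e ^ 2 * g 0) • pu = 0 := by
          have e2 : (2 * e ^ 2 * g 0) • pu =
              e • ((g 0 * e) • pu + (g 2 * -e) • pd) + ((g 0 * e * e) • pu + (g 2 * -e * -e) • pd) := by
            module
          rw [e2, hB, hC, smul_zero, add_zero]
        have h1 := (smul_eq_zero.1 e1).resolve_right hpu0
        exact (mul_eq_zero.1 h1).resolve_left (mul_ne_zero two_ne_zero (pow_ne_zero 2 he))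
      rw [hg0] at hB
      simp only [zero_mul, zero_smul, zero_add] at hB
      have hg2 : g 2 = 0 := by
        have h1 := (smul_eq_zero.1 hB).resolve_right hpd0
        exact (mul_eq_zero.1 h1).resolve_right (neg_ne_zero.2 he)
      rw [hg0, hg2, zero_smul, zero_smul, zero_add, add_zero] at hg
      have hg1 : g 1 = 0 := (smul_eq_zero.1 hg).resolve_right hpz0
      intro i
      fin_cases i <;> assumption
    have hle : Submodule.span ℂ (Set.range ![pu, pz, pd]) ≤ P := by
      rw [Submodule.span_le]
      rintro _ ⟨i, rfl⟩
      fin_cases i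
      · exact hpuP
      · exact hpzP
      · exact hpdP
    have heq : Submodule.span ℂ (Set.range ![pu, pz, pd]) = P :=
      Submodule.eq_of_le_of_finrank_eq hle (by rw [finrank_span_eq_card hli, hP3]; simp)
    intro y hy
    have hy' : y ∈ Submodule.span ℂ (Set.range ![pu, pz, pd]) := by rw [heq]; exact hy
    obtain ⟨c, hc⟩ := (Submodule.mem_span_range_iff_exists_fun ℂ).1 hy'
    refine ⟨c 0, c 1, c 2, ?_⟩
    rw [← hc, Fin.sum_univ_three]
    simp
  have hkillP : ∀ Z : Module.End ℂ M, Z pu = 0 → Z pz = 0 → Z pd = 0 → ∀ p ∈ P, Z p = 0 := by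
    intro Z h1 h2 h3 p hp
    obtain ⟨a, b, c, rfl⟩ := hcoord p hp
    simp only [map_add, map_smul, h1, h2, h3, smul_zero, add_zero]
  -- the shape of an element of `𝔰` in the eigenbasis
  have hshape : ∀ S' ∈ 𝔊, S' * B₀ = B₀ * S' → S' * C₁ = C₁ * S' →
      ∃ a1 b1 a2 c2 b3 c3 : ℂ, S' pu = a1 • pu + b1 • pz ∧ S' pz = a2 • pu + c2 • pd ∧
        S' pd = b3 • pz + c3 • pd ∧ c2 * σ = -(b1 * τ) ∧ b3 * τ = -(a2 * σ) ∧ c3 = -a1 := by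
    intro S' hS' hS'B hS'C
    obtain ⟨hS'P, -⟩ := h𝔰PQ S' hS'B hS'C
    have hk := hsk S' hS' hS'C
    obtain ⟨a1, b1, c1, h1⟩ := hcoord (S' pu) (hS'P pu hpuP)
    obtain ⟨a2, b2, c2, h2⟩ := hcoord (S' pz) (hS'P pz hpzP)
    obtain ⟨a3, b3, c3, h3⟩ := hcoord (S' pd) (hS'P pd hpdP)
    -- diagonal skewness relations
    have hc1 : c1 = 0 := by
      have h := hk pu pu
      rw [h1] at h
      simp only [map_add, map_smul, LinearMap.add_apply, LinearMap.smul_apply, smul_eq_mul, hsuu, hzu, hσ',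
        huz, mul_zero, zero_add, add_zero] at h
      have h' : 2 * σ * c1 = 0 := by linear_combination h
      exact (mul_eq_zero.1 h').resolve_left (mul_ne_zero two_ne_zero hσ)
    have hb2 : b2 = 0 := by
      have h := hk pz pz
      rw [h2] at h
      simp only [map_add, map_smul, LinearMap.add_apply, LinearMap.smul_apply, smul_eq_mul, huz, hzu, hzd,
        hdz, mul_zero, zero_add, add_zero] at h
      have h' : 2 * τ * b2 = 0 := by linear_combination h
      exact (mul_eq_zero.1 h').resolve_left (mul_ne_zero two_ne_zero hτ)
    have ha3 : a3 = 0 := by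
      have h := hk pd pd
      rw [h3] at h
      simp only [map_add, map_smul, LinearMap.add_apply, LinearMap.smul_apply, smul_eq_mul, hsdd, hzd, hσ',
        hdz, mul_zero, add_zero] at h
      have h' : 2 * σ * a3 = 0 := by linear_combination h
      exact (mul_eq_zero.1 h').resolve_left (mul_ne_zero two_ne_zero hσ)
    rw [hc1, zero_smul, add_zero] at h1
    rw [hb2, zero_smul, add_zero] at h2
    rw [ha3, zero_smul, zero_add] at h3
    refine ⟨a1, b1, a2, c2, b3, c3, h1, h2, h3, ?_, ?_, ?_⟩
    · have h := hk pz pu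
      rw [h2, h1] at h
      simp only [map_add, map_smul, LinearMap.add_apply, LinearMap.smul_apply, smul_eq_mul, hzu, hσ', hsuu,
        mul_zero, zero_add] at h
      linear_combination h
    · have h := hk pd pz
      rw [h3, h2] at h
      simp only [map_add, map_smul, LinearMap.add_apply, LinearMap.smul_apply, smul_eq_mul, hdz, hσ', hsdd,
        mul_zero, add_zero] at h
      linear_combination h
    · have h := hk pu pd
      rw [h1, h3] at h
      simp only [map_add, map_smul, LinearMap.add_apply, LinearMap.smul_apply, smul_eq_mul, hzd, huz,
        mul_zero, add_zero, zero_add] at h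
      have h' : σ * (c3 + a1) = 0 := by linear_combination h
      linear_combination (mul_eq_zero.1 h').resolve_left hσ
  -- `𝔰` is bracket-closed
  have h𝔰br : ∀ X ∈ 𝔊, X * B₀ = B₀ * X → X * C₁ = C₁ * X → ∀ Y ∈ 𝔊, Y * B₀ = B₀ * Y → Y * C₁ = C₁ * Y →
      X * Y - Y * X ∈ 𝔊 ∧ (X * Y - Y * X) * B₀ = B₀ * (X * Y - Y * X) ∧
        (X * Y - Y * X) * C₁ = C₁ * (X * Y - Y * X) := by
    intro X hX hXB hXC Y hY hYB hYC
    refine ⟨hbr X hX Y hY, ?_, ?_⟩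
    · have e1 : X * Y * B₀ = B₀ * (X * Y) := by rw [mul_assoc, hYB, ← mul_assoc, hXB, mul_assoc]
      have e2 : Y * X * B₀ = B₀ * (Y * X) := by rw [mul_assoc, hXB, ← mul_assoc, hYB, mul_assoc]
      rw [sub_mul, mul_sub, e1, e2]
    · have e1 : X * Y * C₁ = C₁ * (X * Y) := by rw [mul_assoc, hYC, ← mul_assoc, hXC, mul_assoc]
      have e2 : Y * X * C₁ = C₁ * (Y * X) := by rw [mul_assoc, hXC, ← mul_assoc, hYC, mul_assoc]
      rw [sub_mul, mul_sub, e1, e2]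
  have h𝔰smul : ∀ (c : ℂ) (X : Module.End ℂ M), X ∈ 𝔊 → X * B₀ = B₀ * X → X * C₁ = C₁ * X →
      c • X ∈ 𝔊 ∧ (c • X) * B₀ = B₀ * (c • X) ∧ (c • X) * C₁ = C₁ * (c • X) := fun c X hX hXB hXC =>
    ⟨𝔊.smul_mem c hX, by rw [smul_mul_assoc, mul_smul_comm, hXB], by rw [smul_mul_assoc, mul_smul_comm, hXC]⟩
  -- the raising operator `E'`
  obtain ⟨S₁, hS₁, hS₁B, hS₁C, a1, b1, a2, c2, b3, c3, h1u, h1z, h1d, hR4, hR5, hR6, ha2⟩ :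
      ∃ S₁ ∈ 𝔊, S₁ * B₀ = B₀ * S₁ ∧ S₁ * C₁ = C₁ * S₁ ∧ ∃ a1 b1 a2 c2 b3 c3 : ℂ,
        S₁ pu = a1 • pu + b1 • pz ∧ S₁ pz = a2 • pu + c2 • pd ∧ S₁ pd = b3 • pz + c3 • pd ∧
        c2 * σ = -(b1 * τ) ∧ b3 * τ = -(a2 * σ) ∧ c3 = -a1 ∧ a2 ≠ 0 := by
    by_contra hno
    push Not at hno
    -- then the line `ℂ pd` is `𝔰`-stable
    rcases SymplecticThetaSix.skeleton_irreducible 𝔊 hbr hT𝔊 hTT hP hQ hPmem hQmem hirr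
        (fun h => by rw [h, finrank_bot] at hP3; exact absurd hP3 (by norm_num)) hB₀𝔊 hB₀P hB₀im hC₁𝔊 hC₁Q
        hC₁im hBC hCB hlineS hlineC (ℂ ∙ pd) (by rw [Submodule.span_singleton_le_iff_mem]; exact hpdP)
        (fun S' hS' hS'B hS'C u hu => by
          obtain ⟨c, rfl⟩ := Submodule.mem_span_singleton.1 hu
          obtain ⟨a1, b1, a2, c2, b3, c3, h1, h2, h3, hR4, hR5, hR6⟩ := hshape S' hS' hS'B hS'C
          have ha2 := hno S' hS' hS'B hS'C a1 b1 a2 c2 b3 c3 h1 h2 h3 hR4 hR5 hR6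
          have hb3 : b3 = 0 := by
            rw [ha2, zero_mul, neg_zero] at hR5
            exact (mul_eq_zero.1 hR5).resolve_right hτ
          rw [map_smul, h3, hb3, zero_smul, zero_add, smul_smul]
          exact Submodule.mem_span_singleton.2 ⟨c * c3, rfl⟩) with h | h
    · exact hpd0 (by rw [← Submodule.mem_bot ℂ, ← h]; exact Submodule.mem_span_singleton_self pd)
    · have h1 := finrank_span_singleton (K := ℂ) hpd0
      rw [h, hP3] at h1
      exact absurd h1 (by norm_num)
  set W₁ : Module.End ℂ M := S * S₁ - S₁ * S with hW₁def
  obtain ⟨hX1, hX1B, hX1C⟩ := h𝔰br S hS𝔊 hSB hSC S₁ hS₁ hS₁B hS₁C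
  obtain ⟨hX2, hX2B, hX2C⟩ := h𝔰br S hS𝔊 hSB hSC W₁ hX1 hX1B hX1C
  have hW₁u : W₁ pu = -(e * b1) • pz := by
    rw [hW₁def, LinearMap.sub_apply, Module.End.mul_apply, Module.End.mul_apply, hSpu, map_smul, h1u, map_add,
      map_smul, map_smul, hSpu, hSpz]
    module
  have hW₁z : W₁ pz = (a2 * e) • pu + (-(c2 * e)) • pd := by
    rw [hW₁def, LinearMap.sub_apply, Module.End.mul_apply, Module.End.mul_apply, hSpz, map_zero, h1z, map_add,
      map_smul, map_smul, hSpu, hSpd]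
    module
  have hW₁d : W₁ pd = (e * b3) • pz := by
    rw [hW₁def, LinearMap.sub_apply, Module.End.mul_apply, Module.End.mul_apply, hSpd, map_smul, h1d, map_add,
      map_smul, map_smul, hSpz, hSpd]
    module
  set X : Module.End ℂ M := (S * W₁ - W₁ * S) + e • W₁ with hXdef
  have hX𝔊 : X ∈ 𝔊 := add_mem hX2 (𝔊.smul_mem e hX1)
  have hXB : X * B₀ = B₀ * X := by
    rw [hXdef, add_mul, hX2B, smul_mul_assoc, hX1B, ← mul_smul_comm, ← mul_add]
  have hXC : X * C₁ = C₁ * X := by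
    rw [hXdef, add_mul, hX2C, smul_mul_assoc, hX1C, ← mul_smul_comm, ← mul_add]
  have hXu : X pu = 0 := by
    rw [hXdef, LinearMap.add_apply, LinearMap.sub_apply, LinearMap.smul_apply, Module.End.mul_apply,
      Module.End.mul_apply, hW₁u, hSpu, map_smul, hSpz, map_smul, hW₁u]
    module
  have hXz : X pz = (2 * e ^ 2 * a2) • pu := by
    rw [hXdef, LinearMap.add_apply, LinearMap.sub_apply, LinearMap.smul_apply, Module.End.mul_apply,
      Module.End.mul_apply, hW₁z, hSpz, map_zero, map_add, map_smul, map_smul, hSpu, hSpd]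
    module
  have hXd : X pd = (2 * e ^ 2 * b3) • pz := by
    rw [hXdef, LinearMap.add_apply, LinearMap.sub_apply, LinearMap.smul_apply, Module.End.mul_apply,
      Module.End.mul_apply, hW₁d, hSpd, map_smul, hSpz, map_smul, hW₁d]
    module
  set E' : Module.End ℂ M := (2 * e ^ 2 * a2)⁻¹ • X with hE'def
  have h2a : (2 * e ^ 2 * a2) ≠ 0 := mul_ne_zero (mul_ne_zero two_ne_zero (pow_ne_zero 2 he)) ha2
  obtain ⟨hE'𝔊, hE'B, hE'C⟩ := h𝔰smul (2 * e ^ 2 * a2)⁻¹ X hX𝔊 hXB hXC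
  have hE'u : E' pu = 0 := by rw [hE'def, LinearMap.smul_apply, hXu, smul_zero]
  have hE'z : E' pz = pu := by rw [hE'def, LinearMap.smul_apply, hXz, smul_smul, inv_mul_cancel₀ h2a, one_smul]
  have hE'd : E' pd = -(σ * τ⁻¹) • pz := by
    rw [hE'def, LinearMap.smul_apply, hXd, smul_smul]
    congr 1
    have hb3 : b3 = -(a2 * σ) * τ⁻¹ := by
      rw [← hR5, mul_assoc, mul_inv_cancel₀ hτ, mul_one]
    rw [hb3]
    field_simp
  -- the lowering operator `F'`
  obtain ⟨S₂, hS₂, hS₂B, hS₂C, a1', b1', a2', c2', b3', c3', h2u, h2z, h2d, hR4', hR5', hR6', hb1'⟩ :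
      ∃ S₂ ∈ 𝔊, S₂ * B₀ = B₀ * S₂ ∧ S₂ * C₁ = C₁ * S₂ ∧ ∃ a1 b1 a2 c2 b3 c3 : ℂ,
        S₂ pu = a1 • pu + b1 • pz ∧ S₂ pz = a2 • pu + c2 • pd ∧ S₂ pd = b3 • pz + c3 • pd ∧
        c2 * σ = -(b1 * τ) ∧ b3 * τ = -(a2 * σ) ∧ c3 = -a1 ∧ b1 ≠ 0 := by
    by_contra hno
    push Not at hno
    -- then the line `ℂ pu` is `𝔰`-stable
    rcases SymplecticThetaSix.skeleton_irreducible 𝔊 hbr hT𝔊 hTT hP hQ hPmem hQmem hirr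
        (fun h => by rw [h, finrank_bot] at hP3; exact absurd hP3 (by norm_num)) hB₀𝔊 hB₀P hB₀im hC₁𝔊 hC₁Q
        hC₁im hBC hCB hlineS hlineC (ℂ ∙ pu) (by rw [Submodule.span_singleton_le_iff_mem]; exact hpuP)
        (fun S' hS' hS'B hS'C u hu => by
          obtain ⟨c, rfl⟩ := Submodule.mem_span_singleton.1 hu
          obtain ⟨a1, b1, a2, c2, b3, c3, h1, h2, h3, hR4, hR5, hR6⟩ := hshape S' hS' hS'B hS'C
          have hb1 := hno S' hS' hS'B hS'C a1 b1 a2 c2 b3 c3 h1 h2 h3 hR4 hR5 hR6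
          rw [map_smul, h1, hb1, zero_smul, add_zero, smul_smul]
          exact Submodule.mem_span_singleton.2 ⟨c * a1, rfl⟩) with h | h
    · exact hpu0 (by rw [← Submodule.mem_bot ℂ, ← h]; exact Submodule.mem_span_singleton_self pu)
    · have h1 := finrank_span_singleton (K := ℂ) hpu0
      rw [h, hP3] at h1
      exact absurd h1 (by norm_num)
  set W₂ : Module.End ℂ M := S * S₂ - S₂ * S with hW₂def
  obtain ⟨hY1, hY1B, hY1C⟩ := h𝔰br S hS𝔊 hSB hSC S₂ hS₂ hS₂B hS₂C
  obtain ⟨hY2, hY2B, hY2C⟩ := h𝔰br S hS𝔊 hSB hSC W₂ hY1 hY1B hY1C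
  have hW₂u : W₂ pu = -(e * b1') • pz := by
    rw [hW₂def, LinearMap.sub_apply, Module.End.mul_apply, Module.End.mul_apply, hSpu, map_smul, h2u, map_add,
      map_smul, map_smul, hSpu, hSpz]
    module
  have hW₂z : W₂ pz = (a2' * e) • pu + (-(c2' * e)) • pd := by
    rw [hW₂def, LinearMap.sub_apply, Module.End.mul_apply, Module.End.mul_apply, hSpz, map_zero, h2z, map_add,
      map_smul, map_smul, hSpu, hSpd]
    module
  have hW₂d : W₂ pd = (e * b3') • pz := by
    rw [hW₂def, LinearMap.sub_apply, Module.End.mul_apply, Module.End.mul_apply, hSpd, map_smul, h2d, map_add,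
      map_smul, map_smul, hSpz, hSpd]
    module
  set Y : Module.End ℂ M := (S * W₂ - W₂ * S) - e • W₂ with hYdef
  have hY𝔊 : Y ∈ 𝔊 := sub_mem hY2 (𝔊.smul_mem e hY1)
  have hYB : Y * B₀ = B₀ * Y := by
    rw [hYdef, sub_mul, hY2B, smul_mul_assoc, hY1B, ← mul_smul_comm, ← mul_sub]
  have hYC : Y * C₁ = C₁ * Y := by
    rw [hYdef, sub_mul, hY2C, smul_mul_assoc, hY1C, ← mul_smul_comm, ← mul_sub]
  have hYu : Y pu = (2 * e ^ 2 * b1') • pz := by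
    rw [hYdef, LinearMap.sub_apply, LinearMap.sub_apply, LinearMap.smul_apply, Module.End.mul_apply,
      Module.End.mul_apply, hW₂u, hSpu, map_smul, hSpz, map_smul, hW₂u]
    module
  have hYz : Y pz = (2 * e ^ 2 * c2') • pd := by
    rw [hYdef, LinearMap.sub_apply, LinearMap.sub_apply, LinearMap.smul_apply, Module.End.mul_apply,
      Module.End.mul_apply, hW₂z, hSpz, map_zero, map_add, map_smul, map_smul, hSpu, hSpd]
    module
  have hYd : Y pd = 0 := by
    rw [hYdef, LinearMap.sub_apply, LinearMap.sub_apply, LinearMap.smul_apply, Module.End.mul_apply,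
      Module.End.mul_apply, hW₂d, hSpd, map_smul, hSpz, map_smul, hW₂d]
    module
  set F' : Module.End ℂ M := (2 * e ^ 2 * b1')⁻¹ • Y with hF'def
  have h2b : (2 * e ^ 2 * b1') ≠ 0 := mul_ne_zero (mul_ne_zero two_ne_zero (pow_ne_zero 2 he)) hb1'
  obtain ⟨hF'𝔊, hF'B, hF'C⟩ := h𝔰smul (2 * e ^ 2 * b1')⁻¹ Y hY𝔊 hYB hYC
  have hF'u : F' pu = pz := by rw [hF'def, LinearMap.smul_apply, hYu, smul_smul, inv_mul_cancel₀ h2b, one_smul]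
  have hF'z : F' pz = -(τ * σ⁻¹) • pd := by
    rw [hF'def, LinearMap.smul_apply, hYz, smul_smul]
    congr 1
    have hc2 : c2' = -(b1' * τ) * σ⁻¹ := by
      rw [← hR4', mul_assoc, mul_inv_cancel₀ hσ, mul_one]
    rw [hc2]
    field_simp
  have hF'd : F' pd = 0 := by rw [hF'def, LinearMap.smul_apply, hYd, smul_zero]
  -- `Q`-stability of the players
  have hSQ : ∀ q ∈ Q, S q ∈ Q := (h𝔰PQ S hSB hSC).2
  have hE'Q : ∀ q ∈ Q, E' q ∈ Q := (h𝔰PQ E' hE'B hE'C).2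
  have hF'Q : ∀ q ∈ Q, F' q ∈ Q := (h𝔰PQ F' hF'B hF'C).2
  -- every element of `𝔰` is a combination of `S, E', F'`
  have hspan : ∀ S' ∈ 𝔊, S' * B₀ = B₀ * S' → S' * C₁ = C₁ * S' → ∃ x y z : ℂ, S' = x • S + y • E' + z • F' := by
    intro S' hS' hS'B hS'C
    obtain ⟨a1, b1, a2, c2, b3, c3, h1, h2, h3, hR4, hR5, hR6⟩ := hshape S' hS' hS'B hS'C
    have hS'Q : ∀ q ∈ Q, S' q ∈ Q := (h𝔰PQ S' hS'B hS'C).2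
    have hc2 : c2 = -(b1 * τ) * σ⁻¹ := by rw [← hR4, mul_assoc, mul_inv_cancel₀ hσ, mul_one]
    have hb3 : b3 = -(a2 * σ) * τ⁻¹ := by rw [← hR5, mul_assoc, mul_inv_cancel₀ hτ, mul_one]
    refine ⟨a1 * e⁻¹, a2, b1, ?_⟩
    rw [← sub_eq_zero]
    refine hinj _ (sub_mem hS' (add_mem (add_mem (𝔊.smul_mem _ hS𝔊) (𝔊.smul_mem _ hE'𝔊))
      (𝔊.smul_mem _ hF'𝔊))) (fun q hq => ?_) (hkillP _ ?_ ?_ ?_)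
    · simp only [LinearMap.sub_apply, LinearMap.add_apply, LinearMap.smul_apply]
      exact sub_mem (hS'Q q hq) (add_mem (add_mem (Q.smul_mem _ (hSQ q hq)) (Q.smul_mem _ (hE'Q q hq)))
        (Q.smul_mem _ (hF'Q q hq)))
    · simp only [LinearMap.sub_apply, LinearMap.add_apply, LinearMap.smul_apply, h1, hSpu, hE'u, hF'u, smul_smul,
        mul_assoc, inv_mul_cancel₀ he, mul_one, smul_zero, add_zero]
      module
    · simp only [LinearMap.sub_apply, LinearMap.add_apply, LinearMap.smul_apply, h2, hSpz, hE'z, hF'z, smul_smul,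
        smul_zero, zero_add, hc2]
      match_scalars <;> ring1
    · simp only [LinearMap.sub_apply, LinearMap.add_apply, LinearMap.smul_apply, h3, hSpd, hE'd, hF'd, smul_smul,
        smul_zero, add_zero, hb3, hR6]
      match_scalars <;> first | ring1 | (linear_combination a1 * heinv)
  -- the bracket relations, checked on `P` and transported by `hinj`
  have hB1 : S * E' - E' * S = e • E' := by
    rw [← sub_eq_zero]
    refine hinj _ (sub_mem (hbr S hS𝔊 E' hE'𝔊) (𝔊.smul_mem _ hE'𝔊)) (fun q hq => ?_) (hkillP _ ?_ ?_ ?_)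
    · simp only [LinearMap.sub_apply, LinearMap.smul_apply, Module.End.mul_apply]
      exact sub_mem (sub_mem (hSQ _ (hE'Q q hq)) (hE'Q _ (hSQ q hq))) (Q.smul_mem _ (hE'Q q hq))
    · simp only [LinearMap.sub_apply, LinearMap.smul_apply, Module.End.mul_apply, hE'u, hSpu, map_smul, map_zero,
        smul_zero, sub_zero]
    · simp only [LinearMap.sub_apply, LinearMap.smul_apply, Module.End.mul_apply, hE'z, hSpz, hSpu, map_zero,
        sub_zero, sub_self]
    · simp only [LinearMap.sub_apply, LinearMap.smul_apply, Module.End.mul_apply, hE'd, hSpd, map_smul, map_neg,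
        hSpz, smul_smul, smul_neg, neg_smul]
      module
  have hB2 : S * F' - F' * S = -(e • F') := by
    rw [← sub_eq_zero, sub_neg_eq_add]
    refine hinj _ (add_mem (hbr S hS𝔊 F' hF'𝔊) (𝔊.smul_mem _ hF'𝔊)) (fun q hq => ?_) (hkillP _ ?_ ?_ ?_)
    · simp only [LinearMap.add_apply, LinearMap.sub_apply, LinearMap.smul_apply, Module.End.mul_apply]
      exact add_mem (sub_mem (hSQ _ (hF'Q q hq)) (hF'Q _ (hSQ q hq))) (Q.smul_mem _ (hF'Q q hq))
    · simp only [LinearMap.add_apply, LinearMap.sub_apply, LinearMap.smul_apply, Module.End.mul_apply, hF'u, hSpz,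
        hSpu, map_smul, zero_sub, neg_add_cancel]
    · simp only [LinearMap.add_apply, LinearMap.sub_apply, LinearMap.smul_apply, Module.End.mul_apply, hF'z, hSpz,
        map_smul, map_neg, hSpd, map_zero, sub_zero, smul_smul, smul_neg, neg_smul]
      module
    · simp only [LinearMap.add_apply, LinearMap.sub_apply, LinearMap.smul_apply, Module.End.mul_apply, hF'd, hSpd,
        map_smul, map_zero, smul_zero, zero_sub, neg_zero, zero_add]
  have hB3 : E' * F' - F' * E' = e⁻¹ • S := by
    rw [← sub_eq_zero]
    refine hinj _ (sub_mem (hbr E' hE'𝔊 F' hF'𝔊) (𝔊.smul_mem _ hS𝔊)) (fun q hq => ?_) (hkillP _ ?_ ?_ ?_)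
    · simp only [LinearMap.sub_apply, LinearMap.smul_apply, Module.End.mul_apply]
      exact sub_mem (sub_mem (hE'Q _ (hF'Q q hq)) (hF'Q _ (hE'Q q hq))) (Q.smul_mem _ (hSQ q hq))
    · simp only [LinearMap.sub_apply, LinearMap.smul_apply, Module.End.mul_apply, hF'u, hE'z, hE'u, map_zero,
        sub_zero, hSpu, smul_smul, inv_mul_cancel₀ he, one_smul, sub_self]
    · simp only [LinearMap.sub_apply, LinearMap.smul_apply, Module.End.mul_apply, hF'z, hE'z, hF'u, map_smul,
        hE'd, hSpz, smul_zero, sub_zero, smul_smul]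
      match_scalars
      linear_combination (τ * τ⁻¹) * hσinv + hτinv
    · simp only [LinearMap.sub_apply, LinearMap.smul_apply, Module.End.mul_apply, hF'd, hE'd, map_zero, map_smul,
        hF'z, hSpd, zero_sub, smul_smul]
      match_scalars
      linear_combination heinv - (σ * σ⁻¹) * hτinv - hσinv
  refine ⟨E', hE'𝔊, F', hF'𝔊, hE'B, hE'C, hF'B, hF'C, hE'u, hE'z, ?_, hF'u, ?_, hF'd, hspan, hB1, hB2, hB3⟩
  · rw [hE'd]
  · rw [hF'z]

end Triple

end HodgeStructure

end Literature.AlgebraicGeometry.Motives
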